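import Summits.KontsevichZagierPeriods.KontsevichZagierPeriods.Theorems.HurwitzMicroSectorsNormalFormPrincipleM4DilationMoves
import Summits.KontsevichZagierPeriods.KontsevichZagierPeriods.Theorems.HurwitzMicroSectorsNormalFormPrincipleL2W3RelationsDilation
import Summits.KontsevichZagierPeriods.KontsevichZagierPeriods.Theorems.HyperbolicBlochOffTetraSectorKernelStubAffineOrbit

/-!
# `NormalFormPrinciple` (stmt-KontsevichZagierPeriods-3869), line `SketchIdeator1` —
# leaf `stub_boxRigidity`, layer `M4` packages: the three dilation relations on `Δ₄`

Pure proof file (registered sub-goal `m4_rel_dilations4` of stmt-KontsevichZagierPeriods-3869,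
line `SketchIdeator1`, lead seat c9; layer `M4` packages of the dimension-four campaign of the
leaf `stub_boxRigidity`; `--supports` the crux). Letters on `(0,1)`: `a(u) = 1/u`,
`b(u) = 1/(1−u)`, `c(u) = 1/(1+u)`; word representations
`[x y z w] = [Δ₄, x(t₀) y(t₁) z(t₂) w(t₃)]` on the decreasing open simplex
`Δ₄ = {1 > t₀ > t₁ > t₂ > t₃ > 0}` are the weight-4 iterated integrals. The DILATION
`t ↦ t²` on all four coordinates is ONE change of variables of the Kontsevich–Zagier calculus
(rule (2); the landed generic move `m4_dilation_moves`, which also supplies the pulled-back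
carrier `N`); with the Jacobian `16 s₀s₁s₂s₃` it pulls the letters back as
`a(s²)·2s = 2a(s)`, `b(s²)·2s = b(s) − c(s)` (`l2v_dilation_letter_pulls`) — the
DISTRIBUTION relations of level 2. Expanding the pulled-back integrand by integrand
additivity (rule (1b), iterated as the `ℤ`-combination lemma
`aff_orbit_of_sub_sum_zsmul_mem_relations`) gives

* `∫aaab = ∫(2a)(2a)(2a)(b − c) = 8∫aaab − 8∫aaac`, i.e.
  `8[aaac] − 7[aaab] ∈ KZ.relations`;
* `∫aabb = ∫(2a)(2a)(b − c)(b − c)`, i.e.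
  `4[aabc] + 4[aacb] − 4[aacc] − 3[aabb] ∈ KZ.relations`;
* `∫abab = ∫(2a)(b − c)(2a)(b − c)`, i.e.
  `4[abac] + 4[acab] − 4[acac] − 3[abab] ∈ KZ.relations`.

The word carriers are hypotheses (arbitrary representations on `Δ₄` with the displayed
integrands). Pattern of the dimension-three file `l2w3_relations_dilation`.

References: M. Kontsevich, D. Zagier, *Periods* (2001), §1.2 rules (1b), (2); A. B. Goncharov,
*Multiple polylogarithms and mixed Tate motives* (2001), §2 (distribution relations).
No definitions are introduced.
-/

noncomputable section

open MeasureTheory Set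
open Literature.NumberTheory.Transcendental Literature.NumberTheory.Transcendental.KZ
open Summit.KontsevichZagierPeriods.HyperbolicBloch.OffTetraSectorKernel
  (aff_orbit_of_sub_sum_zsmul_mem_relations)

namespace Summit.KontsevichZagierPeriods.HurwitzMicroSectors.NormalFormPrinciple.PiBox.M3

/-- **Stub (`m4_rel_dilations4`; registered sub-goal of stmt-KontsevichZagierPeriods-3869,
line `SketchIdeator1`, layer `M4` packages).** The three dilation (distribution) relations among
weight-4 level-2 word representations on `Δ₄`:
`8[aaac] − 7[aaab]`, `4[aabc] + 4[aacb] − 4[aacc] − 3[aabb]`,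
`4[abac] + 4[acab] − 4[acac] − 3[abab]` lie in `KZ.relations`, for arbitrary carriers with the
displayed integrands; each is ONE dilation move (rule 2, `m4_dilation_moves`) plus integrand
additivity (rule 1b). [cite: KontsevichZagier2001, §1.2 rules (1), (2)] -/
theorem m4_rel_dilations4 :
    ∀ (AAAB : IntegralRep 4), AAAB.domain = {t | 0 < t 3 ∧ t 3 < t 2 ∧ t 2 < t 1 ∧ t 1 < t 0 ∧ t 0 < 1} → (AAAB.integrand = fun t => 1 / t 0 * (1 / t 1) * (1 / t 2) * (1 / (1 - t 3))) →
      ∀ (AAAC : IntegralRep 4), AAAC.domain = {t | 0 < t 3 ∧ t 3 < t 2 ∧ t 2 < t 1 ∧ t 1 < t 0 ∧ t 0 < 1} → (AAAC.integrand = fun t => 1 / t 0 * (1 / t 1) * (1 / t 2) * (1 / (1 + t 3))) →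
      ∀ (AABB : IntegralRep 4), AABB.domain = {t | 0 < t 3 ∧ t 3 < t 2 ∧ t 2 < t 1 ∧ t 1 < t 0 ∧ t 0 < 1} → (AABB.integrand = fun t => 1 / t 0 * (1 / t 1) * (1 / (1 - t 2)) * (1 / (1 - t 3))) →
      ∀ (AABC : IntegralRep 4), AABC.domain = {t | 0 < t 3 ∧ t 3 < t 2 ∧ t 2 < t 1 ∧ t 1 < t 0 ∧ t 0 < 1} → (AABC.integrand = fun t => 1 / t 0 * (1 / t 1) * (1 / (1 - t 2)) * (1 / (1 + t 3))) →
      ∀ (AACB : IntegralRep 4), AACB.domain = {t | 0 < t 3 ∧ t 3 < t 2 ∧ t 2 < t 1 ∧ t 1 < t 0 ∧ t 0 < 1} → (AACB.integrand = fun t => 1 / t 0 * (1 / t 1) * (1 / (1 + t 2)) * (1 / (1 - t 3))) →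
      ∀ (AACC : IntegralRep 4), AACC.domain = {t | 0 < t 3 ∧ t 3 < t 2 ∧ t 2 < t 1 ∧ t 1 < t 0 ∧ t 0 < 1} → (AACC.integrand = fun t => 1 / t 0 * (1 / t 1) * (1 / (1 + t 2)) * (1 / (1 + t 3))) →
      ∀ (ABAB : IntegralRep 4), ABAB.domain = {t | 0 < t 3 ∧ t 3 < t 2 ∧ t 2 < t 1 ∧ t 1 < t 0 ∧ t 0 < 1} → (ABAB.integrand = fun t => 1 / t 0 * (1 / (1 - t 1)) * (1 / t 2) * (1 / (1 - t 3))) →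
      ∀ (ABAC : IntegralRep 4), ABAC.domain = {t | 0 < t 3 ∧ t 3 < t 2 ∧ t 2 < t 1 ∧ t 1 < t 0 ∧ t 0 < 1} → (ABAC.integrand = fun t => 1 / t 0 * (1 / (1 - t 1)) * (1 / t 2) * (1 / (1 + t 3))) →
      ∀ (ACAB : IntegralRep 4), ACAB.domain = {t | 0 < t 3 ∧ t 3 < t 2 ∧ t 2 < t 1 ∧ t 1 < t 0 ∧ t 0 < 1} → (ACAB.integrand = fun t => 1 / t 0 * (1 / (1 + t 1)) * (1 / t 2) * (1 / (1 - t 3))) →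
      ∀ (ACAC : IntegralRep 4), ACAC.domain = {t | 0 < t 3 ∧ t 3 < t 2 ∧ t 2 < t 1 ∧ t 1 < t 0 ∧ t 0 < 1} → (ACAC.integrand = fun t => 1 / t 0 * (1 / (1 + t 1)) * (1 / t 2) * (1 / (1 + t 3))) →
      ((8:ℤ) • of AAAC - (7:ℤ) • of AAAB ∈ relations) ∧
      ((4:ℤ) • of AABC + (4:ℤ) • of AACB - (4:ℤ) • of AACC - (3:ℤ) • of AABB ∈ relations) ∧
      ((4:ℤ) • of ABAC + (4:ℤ) • of ACAB - (4:ℤ) • of ACAC - (3:ℤ) • of ABAB ∈ relations) := by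
  intro AAAB hAAABd hAAABi AAAC hAAACd hAAACi AABB hAABBd hAABBi AABC hAABCd hAABCi
    AACB hAACBd hAACBi AACC hAACCd hAACCi ABAB hABABd hABABi ABAC hABACd hABACi
    ACAB hACABd hACABi ACAC hACACd hACACi
  refine ⟨?_, ?_, ?_⟩
  · -- (1) the dilation move on the word `a a a b`
    have hTi : EqOn AAAB.integrand (fun t => (fun u : ℝ => 1 / u) (t 0) *
        (fun u : ℝ => 1 / u) (t 1) * (fun u : ℝ => 1 / u) (t 2) *
        (fun u : ℝ => 1 / (1 - u)) (t 3)) AAAB.domain := fun t _ => by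
      simp only [hAAABi]
    obtain ⟨hmove, N, hNd, hNi⟩ := m4_dilation_moves.1 (fun u => 1 / u) (fun u => 1 / u)
      (fun u => 1 / u) (fun u => 1 / (1 - u)) AAAB hAAABd hTi
    have m1 : of N - of AAAB ∈ relations := hmove N hNd (hNi ▸ fun _ _ => rfl)
    -- rule (1b) on `Δ₄`: `[N] = 8[AAAB] − 8[AAAC]`
    have m2 : of N - ((8:ℤ) • of AAAB + (-8:ℤ) • of AAAC) ∈ relations := by
      have h := aff_orbit_of_sub_sum_zsmul_mem_relations (Finset.univ : Finset (Fin 2))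
        ![AAAB, AAAC] ![8, -8] N (fun i _ => by
          fin_cases i
          · exact hAAABd.trans hNd.symm
          · exact hAAACd.trans hNd.symm) fun t ht => ?_
      · simpa [Fin.sum_univ_two] using h
      rw [hNd] at ht
      have hf := m4s_mem_Ioo_of_mem_simplex4 ht
      rw [hNi]
      simp only [Fin.sum_univ_two, Matrix.cons_val_zero, Matrix.cons_val_one, hAAABi,
        hAAACi]
      rw [(l2v_dilation_letter_pulls (hf 0).1 (hf 0).2).1,
        (l2v_dilation_letter_pulls (hf 1).1 (hf 1).2).1,
        (l2v_dilation_letter_pulls (hf 2).1 (hf 2).2).1,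
        (l2v_dilation_letter_pulls (hf 3).1 (hf 3).2).2]
      push_cast
      ring
    have e : (8:ℤ) • of AAAC - (7:ℤ) • of AAAB =
        (of N - ((8:ℤ) • of AAAB + (-8:ℤ) • of AAAC)) - (of N - of AAAB) := by
      simp only [neg_smul]; abel
    rw [e]
    exact relations.sub_mem m2 m1
  · -- (2) the dilation move on the word `a a b b`
    have hTi : EqOn AABB.integrand (fun t => (fun u : ℝ => 1 / u) (t 0) *
        (fun u : ℝ => 1 / u) (t 1) * (fun u : ℝ => 1 / (1 - u)) (t 2) *
        (fun u : ℝ => 1 / (1 - u)) (t 3)) AABB.domain := fun t _ => by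
      simp only [hAABBi]
    obtain ⟨hmove, N, hNd, hNi⟩ := m4_dilation_moves.1 (fun u => 1 / u) (fun u => 1 / u)
      (fun u => 1 / (1 - u)) (fun u => 1 / (1 - u)) AABB hAABBd hTi
    have m1 : of N - of AABB ∈ relations := hmove N hNd (hNi ▸ fun _ _ => rfl)
    -- rule (1b) on `Δ₄`: `[N] = 4[AABB] − 4[AABC] − 4[AACB] + 4[AACC]`
    have m2 : of N - ((4:ℤ) • of AABB + (-4:ℤ) • of AABC + (-4:ℤ) • of AACB +
        (4:ℤ) • of AACC) ∈ relations := by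
      have h := aff_orbit_of_sub_sum_zsmul_mem_relations (Finset.univ : Finset (Fin 4))
        ![AABB, AABC, AACB, AACC] ![4, -4, -4, 4] N (fun i _ => by
          fin_cases i
          · exact hAABBd.trans hNd.symm
          · exact hAABCd.trans hNd.symm
          · exact hAACBd.trans hNd.symm
          · exact hAACCd.trans hNd.symm) fun t ht => ?_
      · simpa [Fin.sum_univ_four, add_assoc] using h
      rw [hNd] at ht
      have hf := m4s_mem_Ioo_of_mem_simplex4 ht
      rw [hNi]
      simp only [Fin.sum_univ_four, Matrix.cons_val_zero, Matrix.cons_val_one,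
        Matrix.cons_val_two, Matrix.cons_val_three, Matrix.head_cons, Matrix.tail_cons, hAABBi,
        hAABCi, hAACBi, hAACCi]
      rw [(l2v_dilation_letter_pulls (hf 0).1 (hf 0).2).1,
        (l2v_dilation_letter_pulls (hf 1).1 (hf 1).2).1,
        (l2v_dilation_letter_pulls (hf 2).1 (hf 2).2).2,
        (l2v_dilation_letter_pulls (hf 3).1 (hf 3).2).2]
      push_cast
      ring
    have e : (4:ℤ) • of AABC + (4:ℤ) • of AACB - (4:ℤ) • of AACC - (3:ℤ) • of AABB =
        (of N - ((4:ℤ) • of AABB + (-4:ℤ) • of AABC + (-4:ℤ) • of AACB +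
          (4:ℤ) • of AACC)) - (of N - of AABB) := by
      simp only [neg_smul]; abel
    rw [e]
    exact relations.sub_mem m2 m1
  · -- (3) the dilation move on the word `a b a b`
    have hTi : EqOn ABAB.integrand (fun t => (fun u : ℝ => 1 / u) (t 0) *
        (fun u : ℝ => 1 / (1 - u)) (t 1) * (fun u : ℝ => 1 / u) (t 2) *
        (fun u : ℝ => 1 / (1 - u)) (t 3)) ABAB.domain := fun t _ => by
      simp only [hABABi]
    obtain ⟨hmove, N, hNd, hNi⟩ := m4_dilation_moves.1 (fun u => 1 / u) (fun u => 1 / (1 - u))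
      (fun u => 1 / u) (fun u => 1 / (1 - u)) ABAB hABABd hTi
    have m1 : of N - of ABAB ∈ relations := hmove N hNd (hNi ▸ fun _ _ => rfl)
    -- rule (1b) on `Δ₄`: `[N] = 4[ABAB] − 4[ABAC] − 4[ACAB] + 4[ACAC]`
    have m2 : of N - ((4:ℤ) • of ABAB + (-4:ℤ) • of ABAC + (-4:ℤ) • of ACAB +
        (4:ℤ) • of ACAC) ∈ relations := by
      have h := aff_orbit_of_sub_sum_zsmul_mem_relations (Finset.univ : Finset (Fin 4))
        ![ABAB, ABAC, ACAB, ACAC] ![4, -4, -4, 4] N (fun i _ => by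
          fin_cases i
          · exact hABABd.trans hNd.symm
          · exact hABACd.trans hNd.symm
          · exact hACABd.trans hNd.symm
          · exact hACACd.trans hNd.symm) fun t ht => ?_
      · simpa [Fin.sum_univ_four, add_assoc] using h
      rw [hNd] at ht
      have hf := m4s_mem_Ioo_of_mem_simplex4 ht
      rw [hNi]
      simp only [Fin.sum_univ_four, Matrix.cons_val_zero, Matrix.cons_val_one,
        Matrix.cons_val_two, Matrix.cons_val_three, Matrix.head_cons, Matrix.tail_cons, hABABi,
        hABACi, hACABi, hACACi]
      rw [(l2v_dilation_letter_pulls (hf 0).1 (hf 0).2).1,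
        (l2v_dilation_letter_pulls (hf 1).1 (hf 1).2).2,
        (l2v_dilation_letter_pulls (hf 2).1 (hf 2).2).1,
        (l2v_dilation_letter_pulls (hf 3).1 (hf 3).2).2]
      push_cast
      ring
    have e : (4:ℤ) • of ABAC + (4:ℤ) • of ACAB - (4:ℤ) • of ACAC - (3:ℤ) • of ABAB =
        (of N - ((4:ℤ) • of ABAB + (-4:ℤ) • of ABAC + (-4:ℤ) • of ACAB +
          (4:ℤ) • of ACAC)) - (of N - of ABAB) := by
      simp only [neg_smul]; abel
    rw [e]
    exact relations.sub_mem m2 m1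

end Summit.KontsevichZagierPeriods.HurwitzMicroSectors.NormalFormPrinciple.PiBox.M3
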